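import Literature.Topology.FourManifolds.InfiniteCyclicCover
import Literature.AlgebraicTopology.SingularHomology.ClopenAdditivity
import HarnessLib

/-!
# Sheets of the infinite cyclic cover over the complement of a level set

Topic `Literature/Topology/FourManifolds`, continuing `InfiniteCyclicCover.lean` (the cover
`X̃ = CircleMaps.CyclicCover f = {(x, s) | f x = exp s}` of `X` defined by `f : X → S¹`, with deck
action `k +ᵥ (x, s) = (x, s + 2πk)`). Over the open set `{f ≠ exp a}` — the complement of the
"cut" `F = f⁻¹(exp a)`, e.g. of a Seifert surface when `f` is the circle-valued map of a knot
exterior — the covering is **trivial**: the branch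
`sheetLevel f a x = a + π + arg (f x · exp (-(a + π))) ∈ (a, a + 2π]` of the level is continuous
off `F` and `exp (sheetLevel f a x) = f x`, so that

* `sheetSection f a k : X → X̃`, `x ↦ (x, sheetLevel f a x + 2πk)`, is a section of `proj`,
  continuous off `F`, and the deck transformations permute these sections (`vadd_sheetSection`);
* the **sheets** `sheet f a k = {p | f (proj p) ≠ exp a, level p ∈ (a + 2πk, a + 2πk + 2π)}` are
  open, pairwise disjoint, permuted by the deck action and cover `proj⁻¹ {f ≠ exp a}`; a point of
  the `k`-th sheet is `sheetSection f a k` of its projection (`eq_sheetSection_of_mem_sheet`);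
* over any `Y ⊆ {f ≠ exp a}` the preimage `proj⁻¹ Y ⊆ X̃` is thereby the disjoint union of the
  copies `sheetEmb f a Y k : ↥Y → ↥(proj ⁻¹' Y)` of `Y` (`sheetIn`, `isClopenPartition_sheetIn`,
  `sheetInHomeomorph`), which is the decomposition `p⁻¹(S³ ∖ F) = ⊔ₖ Yₖ` of D. Rolfsen, *Knots and
  Links* (1976), §8.C, read inside the pull-back cover rather than by cutting and pasting; and
* **additivity over the sheets** (`ClopenAdditivity.lean`, Hatcher Prop. 2.6):
  `Hₙ(proj⁻¹ Y; M)` is the direct sum of the copies `(sheetEmb f a Y k)_* Hₙ(Y; M)`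
  (`exists_eq_sum_map_sheetEmb`, `eq_zero_of_sum_map_sheetEmb_eq_zero`, `map_sheetEmb_injective`),
  the deck transformation by `m` carrying the `k`-th copy to the `(k + m)`-th
  (`deckOn_comp_sheetEmb`).

Everything is proved; no named fact is introduced. This is the point-set half of the
Mayer–Vietoris computation of `H₁(X̃)` (Rolfsen §8.C; Lickorish (1997) Thm. 6.5).

## References

* D. Rolfsen, *Knots and Links*, Publish or Perish (1976), §7.A, §8.C. [Rolfsen1976]
* A. Hatcher, *Algebraic Topology*, CUP (2002), §1.3 (sheets over an evenly covered set),
  Prop. 2.6. [HatcherAT2002]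
-/

noncomputable section

open Set Function Complex
open scoped Real Topology
open Literature.AlgebraicTopology.SingularHomology

universe u

namespace Literature.Topology.FourManifolds

namespace CircleMaps

namespace CyclicCover

/-! ### Points of the circle off `-1` -/

/-- A point of the unit circle with `re ≤ 0` and `im = 0` is `-1`. [folklore] -/
theorem coe_eq_neg_one_of_re_nonpos_of_im_eq_zero {w : Circle} (hre : (w : ℂ).re ≤ 0)
    (him : (w : ℂ).im = 0) : (w : ℂ) = -1 := by
  have hsq : (w : ℂ).re * (w : ℂ).re = 1 := by
    have := Circle.normSq_coe w
    rwa [Complex.normSq_apply, him, mul_zero, add_zero] at this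
  have hre1 : (w : ℂ).re = -1 := by nlinarith
  exact Complex.ext (by simpa using hre1) (by simpa using him)

/-- A point `w ≠ -1` of the unit circle lies in the slit plane (so that `arg` is continuous at
it). [folklore] -/
theorem coe_mem_slitPlane_of_ne {w : Circle} (hw : (w : ℂ) ≠ -1) : (w : ℂ) ∈ slitPlane := by
  rw [mem_slitPlane_iff]
  by_contra hcon
  rw [not_or, not_lt, not_ne_iff] at hcon
  exact hw (coe_eq_neg_one_of_re_nonpos_of_im_eq_zero hcon.1 hcon.2)

/-- A point `w ≠ -1` of the unit circle has `arg w < π`. [folklore] -/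
theorem arg_coe_lt_pi_of_ne {w : Circle} (hw : (w : ℂ) ≠ -1) : (w : ℂ).arg < π := by
  refine lt_of_le_of_ne (Complex.arg_le_pi _) fun h => ?_
  rw [Complex.arg_eq_pi_iff] at h
  exact hw (coe_eq_neg_one_of_re_nonpos_of_im_eq_zero h.1.le h.2)

/-- `exp π = -1` on the circle. [folklore] -/
theorem coe_exp_pi : ((Circle.exp π : Circle) : ℂ) = -1 := by
  rw [Circle.coe_exp, Complex.exp_pi_mul_I]

variable {X : Type u} [TopologicalSpace X] (f : C(X, Circle))

/-! ### The branch of the level over the complement of a cut value -/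

/-- The circle point `f x · exp (-(a + π))`; it is `-1` exactly when `f x = exp a`. [folklore] -/
def cutTwist (a : ℝ) (x : X) : Circle := f x * Circle.exp (-(a + π))

/-- `cutTwist f a` is continuous. [folklore] -/
@[fun_prop]
theorem continuous_cutTwist (a : ℝ) : Continuous (cutTwist f a) := by
  unfold cutTwist
  fun_prop

/-- `cutTwist f a x = -1` iff `f x = exp a`. [folklore] -/
theorem coe_cutTwist_eq_neg_one_iff (a : ℝ) (x : X) :
    ((cutTwist f a x : Circle) : ℂ) = -1 ↔ f x = Circle.exp a := by
  rw [← coe_exp_pi, Circle.coe_inj, cutTwist, Circle.exp_neg, mul_inv_eq_iff_eq_mul, ← Circle.exp_add,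
    show π + (a + π) = a + 2 * π by ring, Circle.exp_add_two_pi]

/-- **The branch of the level over `{f ≠ exp a}`** with values in `(a, a + 2π]`:
`a + π + arg (f x · exp (-(a + π)))`. [folklore] -/
def sheetLevel (a : ℝ) (x : X) : ℝ := a + π + ((cutTwist f a x : Circle) : ℂ).arg

/-- `exp (sheetLevel f a x) = f x` for every `x`. [folklore] -/
theorem exp_sheetLevel (a : ℝ) (x : X) : Circle.exp (sheetLevel f a x) = f x := by
  rw [sheetLevel, Circle.exp_add, Circle.exp_arg, cutTwist, Circle.exp_neg, mul_comm (f x),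
    mul_inv_cancel_left]

/-- `a < sheetLevel f a x`. [folklore] -/
theorem lt_sheetLevel (a : ℝ) (x : X) : a < sheetLevel f a x := by
  have := Complex.neg_pi_lt_arg ((cutTwist f a x : Circle) : ℂ)
  rw [sheetLevel]
  linarith

/-- `sheetLevel f a x ≤ a + 2π`. [folklore] -/
theorem sheetLevel_le (a : ℝ) (x : X) : sheetLevel f a x ≤ a + 2 * π := by
  have := Complex.arg_le_pi ((cutTwist f a x : Circle) : ℂ)
  rw [sheetLevel]
  linarith

/-- Off the cut, `sheetLevel f a x < a + 2π`. [folklore] -/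
theorem sheetLevel_lt (a : ℝ) {x : X} (hx : f x ≠ Circle.exp a) : sheetLevel f a x < a + 2 * π := by
  have := arg_coe_lt_pi_of_ne (mt (coe_cutTwist_eq_neg_one_iff f a x).1 hx)
  rw [sheetLevel]
  linarith

/-- Off the cut, `sheetLevel f a x ∈ (a, a + 2π)`. [folklore] -/
theorem sheetLevel_mem_Ioo (a : ℝ) {x : X} (hx : f x ≠ Circle.exp a) :
    sheetLevel f a x ∈ Ioo a (a + 2 * π) :=
  ⟨lt_sheetLevel f a x, sheetLevel_lt f a hx⟩

/-- **Off the cut, the branch is continuous.** [folklore] -/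
theorem continuousAt_sheetLevel (a : ℝ) {x : X} (hx : f x ≠ Circle.exp a) :
    ContinuousAt (sheetLevel f a) x := by
  refine continuousAt_const.add ((Complex.continuousAt_arg ?_).comp ?_)
  · exact coe_mem_slitPlane_of_ne (mt (coe_cutTwist_eq_neg_one_iff f a x).1 hx)
  · exact (continuous_subtype_val.comp (continuous_cutTwist f a)).continuousAt

/-- Continuity of the branch on the complement of the cut. [folklore] -/
theorem continuousOn_sheetLevel (a : ℝ) : ContinuousOn (sheetLevel f a) {x | f x ≠ Circle.exp a} :=
  fun _ hx => (continuousAt_sheetLevel f a hx).continuousWithinAt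

/-- **Two real lifts of the same circle point in one window of length `2π` coincide.** [folklore] -/
theorem eq_of_exp_eq_of_mem_Ioo {s t b : ℝ} (h : Circle.exp s = Circle.exp t) (hs : s ∈ Ioo b (b + 2 * π))
    (ht : t ∈ Ioo b (b + 2 * π)) : s = t := by
  obtain ⟨m, hm⟩ := Circle.exp_eq_exp.1 h
  have h1 : |(m : ℝ) * (2 * π)| < 2 * π := by
    have : (m : ℝ) * (2 * π) = s - t := by rw [hm]; ring
    rw [this, abs_sub_lt_iff]
    constructor <;> linarith [hs.1, hs.2, ht.1, ht.2]
  rw [abs_mul, abs_of_pos Real.two_pi_pos] at h1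
  have h2 : |(m : ℝ)| < 1 := lt_of_mul_lt_mul_right (by rwa [one_mul]) Real.two_pi_pos.le
  have h3 : m = 0 := Int.abs_lt_one_iff.1 (by exact_mod_cast h2)
  rw [hm, h3]
  simp

/-- The level of a point of the cover lying in the window `(a + 2πk, a + 2πk + 2π)` is the
branch of its projection shifted by `2πk`. [folklore] -/
theorem level_eq_sheetLevel_add (a : ℝ) {k : ℤ} {p : CyclicCover f} (hp : f (proj p) ≠ Circle.exp a)
    (hk : level p ∈ Ioo (a + k * (2 * π)) (a + k * (2 * π) + 2 * π)) :
    level p = sheetLevel f a (proj p) + k * (2 * π) := by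
  have hs := sheetLevel_mem_Ioo f a hp
  refine eq_of_exp_eq_of_mem_Ioo (b := a + k * (2 * π)) ?_ hk ⟨by linarith [hs.1], by linarith [hs.2]⟩
  rw [← apply_proj, Circle.exp_add, Circle.exp_int_mul_two_pi, mul_one, exp_sheetLevel]

/-! ### The sections over the complement of the cut -/

/-- **The `k`-th section** `x ↦ (x, sheetLevel f a x + 2πk)` of the cover (continuous off the cut).
[folklore] -/
def sheetSection (a : ℝ) (k : ℤ) (x : X) : CyclicCover f :=
  mk x (sheetLevel f a x + k * (2 * π))
    (by rw [Circle.exp_add, Circle.exp_int_mul_two_pi, mul_one, exp_sheetLevel])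

/-- The section is a section. [folklore] -/
@[simp] theorem proj_sheetSection (a : ℝ) (k : ℤ) (x : X) : proj (sheetSection f a k x) = x := rfl

/-- The level of the section. [folklore] -/
@[simp] theorem level_sheetSection (a : ℝ) (k : ℤ) (x : X) :
    level (sheetSection f a k x) = sheetLevel f a x + k * (2 * π) := rfl

/-- The deck transformations permute the sections: `m +ᵥ` (section `k`) `=` section `k + m`.
[folklore] -/
theorem vadd_sheetSection (a : ℝ) (m k : ℤ) (x : X) :
    m +ᵥ sheetSection f a k x = sheetSection f a (k + m) x :=
  CyclicCover.ext rfl (by simp only [level_vadd, level_sheetSection]; push_cast; ring)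

/-- Off the cut, the sections are continuous. [folklore] -/
theorem continuousAt_sheetSection (a : ℝ) (k : ℤ) {x : X} (hx : f x ≠ Circle.exp a) :
    ContinuousAt (sheetSection f a k) x :=
  continuousAt_mk continuousAt_id ((continuousAt_sheetLevel f a hx).add continuousAt_const) _

/-! ### The sheets -/

/-- **The `k`-th sheet over `{f ≠ exp a}`**: the points of the cover projecting off the cut with
level in the window `(a + 2πk, a + 2πk + 2π)` (Rolfsen 1976, §8.C: the copies `Yₖ` of the cut-open
complement inside `X̃`). [cite: Rolfsen1976, §8.C] -/
def sheet (a : ℝ) (k : ℤ) : Set (CyclicCover f) :=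
  {p | f (proj p) ≠ Circle.exp a ∧ level p ∈ Ioo (a + k * (2 * π)) (a + k * (2 * π) + 2 * π)}

variable {f}

/-- Membership in a sheet. [folklore] -/
theorem mem_sheet_iff {a : ℝ} {k : ℤ} {p : CyclicCover f} :
    p ∈ sheet f a k ↔ f (proj p) ≠ Circle.exp a ∧
      level p ∈ Ioo (a + k * (2 * π)) (a + k * (2 * π) + 2 * π) :=
  Iff.rfl

/-- **A point of the `k`-th sheet is the `k`-th section of its projection.** [folklore] -/
theorem eq_sheetSection_of_mem_sheet {a : ℝ} {k : ℤ} {p : CyclicCover f} (hp : p ∈ sheet f a k) :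
    p = sheetSection f a k (proj p) :=
  CyclicCover.ext rfl (by rw [level_sheetSection]; exact level_eq_sheetLevel_add f a hp.1 hp.2)

/-- The `k`-th section lands in the `k`-th sheet (off the cut). [folklore] -/
theorem sheetSection_mem_sheet {a : ℝ} (k : ℤ) {x : X} (hx : f x ≠ Circle.exp a) :
    sheetSection f a k x ∈ sheet f a k := by
  refine ⟨hx, ?_⟩
  have hs := sheetLevel_mem_Ioo f a hx
  simp only [level_sheetSection, mem_Ioo]
  constructor <;> linarith [hs.1, hs.2]

/-- Membership in a sheet, as a fixed-point statement. [folklore] -/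
theorem mem_sheet_iff_eq_sheetSection {a : ℝ} {k : ℤ} {p : CyclicCover f} :
    p ∈ sheet f a k ↔ f (proj p) ≠ Circle.exp a ∧ p = sheetSection f a k (proj p) :=
  ⟨fun hp => ⟨hp.1, eq_sheetSection_of_mem_sheet hp⟩,
    fun ⟨hp, he⟩ => he ▸ sheetSection_mem_sheet k hp⟩

variable (f)

/-- The sheets are open. [folklore] -/
theorem isOpen_sheet (a : ℝ) (k : ℤ) : IsOpen (sheet f a k) := by
  refine IsOpen.inter ?_ (isOpen_Ioo.preimage continuous_level)
  have : IsOpen {u : Circle | u ≠ Circle.exp a} := isOpen_ne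
  exact (this.preimage f.continuous).preimage continuous_proj

/-- Distinct sheets are disjoint. [folklore] -/
theorem disjoint_sheet (a : ℝ) {j k : ℤ} (hjk : j ≠ k) : Disjoint (sheet f a j) (sheet f a k) := by
  rw [Set.disjoint_left]
  intro p hj hk
  have ej := eq_sheetSection_of_mem_sheet hj
  have ek := eq_sheetSection_of_mem_sheet hk
  have := congrArg level (ej.symm.trans ek)
  simp only [level_sheetSection, add_right_inj] at this
  have h' : (j : ℝ) = k := by
    have := mul_right_cancel₀ (by positivity : (2 * π : ℝ) ≠ 0) this
    exact this
  exact hjk (by exact_mod_cast h')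

/-- The sheets cover the preimage of the complement of the cut. [folklore] -/
theorem mem_iUnion_sheet_iff (a : ℝ) {p : CyclicCover f} :
    p ∈ ⋃ k, sheet f a k ↔ f (proj p) ≠ Circle.exp a := by
  rw [mem_iUnion]
  constructor
  · rintro ⟨k, hk⟩
    exact hk.1
  · intro hp
    obtain ⟨m, hm⟩ := exists_vadd_eq_of_proj_eq (p := p) (q := sheetSection f a 0 (proj p)) rfl
    refine ⟨m, ?_⟩
    rw [← hm, vadd_sheetSection, zero_add]
    exact sheetSection_mem_sheet m hp

/-- **The deck transformations permute the sheets**: `m +ᵥ p ∈` sheet `(k + m)` iff `p ∈` sheet `k`.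
[folklore] -/
theorem vadd_mem_sheet_iff (a : ℝ) (m k : ℤ) (p : CyclicCover f) :
    m +ᵥ p ∈ sheet f a (k + m) ↔ p ∈ sheet f a k := by
  rw [mem_sheet_iff_eq_sheetSection, mem_sheet_iff_eq_sheetSection, proj_vadd, ← vadd_sheetSection,
    (AddAction.injective m).eq_iff]

/-! ### The sheets over a subset `Y` of the complement of the cut -/

section Over

variable {f} {a : ℝ} {Y : Set X} (hY : ∀ x ∈ Y, f x ≠ Circle.exp a)
include hY

/-- **The copy of `Y` in the `k`-th sheet**: `y ↦ (y, sheetLevel f a y + 2πk)` as a continuous map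
`↥Y → ↥(proj⁻¹ Y)` (Rolfsen 1976, §8.C, the lifts `Yₖ`). [cite: Rolfsen1976, §8.C] -/
def sheetEmb (k : ℤ) : C(↥Y, ↥((proj : CyclicCover f → X) ⁻¹' Y)) where
  toFun y := ⟨sheetSection f a k y, y.2⟩
  continuous_toFun := by
    refine Continuous.subtype_mk ?_ _
    exact continuousOn_iff_continuous_restrict.1
      (fun x hx => (continuousAt_sheetSection f a k (hY x hx)).continuousWithinAt)

/-- The copy of `y` in the `k`-th sheet, as a point of the cover. [folklore] -/
@[simp] theorem coe_sheetEmb (k : ℤ) (y : Y) : (sheetEmb hY k y : CyclicCover f) = sheetSection f a k y :=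
  rfl

/-- `proj ∘ sheetEmb = val`. [folklore] -/
theorem proj_sheetEmb (k : ℤ) (y : Y) : proj (sheetEmb hY k y : CyclicCover f) = y := rfl

/-- The copies of `Y` are injective. [folklore] -/
theorem sheetEmb_injective (k : ℤ) : Injective (sheetEmb hY k) := fun _ _ h =>
  Subtype.ext (congrArg (fun q : ↥((proj : CyclicCover f → X) ⁻¹' Y) => proj (q : CyclicCover f)) h)

/-- **The `k`-th sheet over `Y`**, as a subset of the subspace `proj⁻¹ Y` of the cover. [folklore] -/
def sheetIn (Y : Set X) (a : ℝ) (k : ℤ) : Set ↥((proj : CyclicCover f → X) ⁻¹' Y) :=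
  Subtype.val ⁻¹' sheet f a k

omit hY in
/-- Membership in a sheet over `Y`. [folklore] -/
@[simp] theorem mem_sheetIn_iff {k : ℤ} {q : ↥((proj : CyclicCover f → X) ⁻¹' Y)} :
    q ∈ sheetIn (f := f) Y a k ↔ (q : CyclicCover f) ∈ sheet f a k :=
  Iff.rfl

/-- **The sheets over `Y` form a clopen partition of `proj⁻¹ Y`.** [folklore] -/
theorem isClopenPartition_sheetIn : IsClopenPartition (sheetIn (f := f) Y a) where
  isOpen k := (isOpen_sheet f a k).preimage continuous_subtype_val
  disjoint j k hjk := (disjoint_sheet f a hjk).preimage Subtype.val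
  exists_mem q := by
    have hq : f (proj (q : CyclicCover f)) ≠ Circle.exp a := hY _ q.2
    obtain ⟨k, hk⟩ := mem_iUnion.1 ((mem_iUnion_sheet_iff f a).2 hq)
    exact ⟨k, hk⟩

/-- The range of the `k`-th copy of `Y` is the `k`-th sheet over `Y`. [folklore] -/
theorem range_sheetEmb (k : ℤ) : range (sheetEmb hY k) = sheetIn (f := f) Y a k := by
  ext q
  constructor
  · rintro ⟨y, rfl⟩
    exact sheetSection_mem_sheet k (hY y y.2)
  · intro hq
    refine ⟨⟨proj (q : CyclicCover f), q.2⟩, Subtype.ext ?_⟩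
    exact (eq_sheetSection_of_mem_sheet hq).symm

/-- **The `k`-th sheet over `Y` is homeomorphic to `Y`** (by `proj`, with inverse the `k`-th copy).
[folklore] -/
def sheetInHomeomorph (k : ℤ) : ↥Y ≃ₜ ↥(sheetIn (f := f) Y a k) where
  toFun y := ⟨sheetEmb hY k y, (range_sheetEmb hY k) ▸ mem_range_self y⟩
  invFun q := ⟨proj ((q : ↥((proj : CyclicCover f → X) ⁻¹' Y)) : CyclicCover f), q.1.2⟩
  left_inv _ := rfl
  right_inv q := Subtype.ext (Subtype.ext (eq_sheetSection_of_mem_sheet q.2).symm)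
  continuous_toFun := (sheetEmb hY k).continuous.subtype_mk _
  continuous_invFun :=
    (continuous_proj.comp (continuous_subtype_val.comp continuous_subtype_val)).subtype_mk _

/-- The copy map factors as the homeomorphism onto the sheet followed by the inclusion. [folklore] -/
theorem subsetIncl_comp_sheetInHomeomorph (k : ℤ) :
    (subsetIncl (sheetIn (f := f) Y a k)).comp (sheetInHomeomorph hY k : C(↥Y, ↥(sheetIn (f := f) Y a k))) =
      sheetEmb hY k :=
  rfl

/-- **The deck transformation by `m`, restricted to `proj⁻¹ Y`.** [folklore] -/
def deckOn (Y : Set X) (m : ℤ) :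
    C(↥((proj : CyclicCover f → X) ⁻¹' Y), ↥((proj : CyclicCover f → X) ⁻¹' Y)) where
  toFun q := ⟨m +ᵥ (q : CyclicCover f), q.2⟩
  continuous_toFun := ((continuous_const_vadd m).comp continuous_subtype_val).subtype_mk _

omit hY in
/-- `deckOn` is the deck transformation. [folklore] -/
@[simp] theorem coe_deckOn_apply (m : ℤ) (q : ↥((proj : CyclicCover f → X) ⁻¹' Y)) :
    (deckOn (f := f) Y m q : CyclicCover f) = m +ᵥ (q : CyclicCover f) := rfl

/-- **The deck transformation by `m` carries the `k`-th copy of `Y` to the `(k + m)`-th.**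
[folklore] -/
theorem deckOn_comp_sheetEmb (m k : ℤ) :
    (deckOn (f := f) Y m).comp (sheetEmb hY k) = sheetEmb hY (k + m) := by
  ext y : 2
  exact vadd_sheetSection f a m k y

/-! ### Additivity of homology over the sheets -/

variable (R : Type) [CommRing R] (M : Type) [AddCommGroup M] [Module R M]

omit hY in
/-- Pushing forward along a homeomorphism and then along its inverse is the identity. [folklore] -/
theorem map_homeomorph_symm_map {P Q : Type u} [TopologicalSpace P] [TopologicalSpace Q] (e : P ≃ₜ Q)
    (n : ℕ) (c : singularHomology R M P n) :
    singularHomology.map R M (e.symm : C(Q, P)) n (singularHomology.map R M (e : C(P, Q)) n c) = c := by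
  rw [← ModuleCat.comp_apply, ← singularHomology.map_comp]
  have : (e.symm : C(Q, P)).comp (e : C(P, Q)) = ContinuousMap.id P := by
    ext p
    exact e.symm_apply_apply p
  rw [this, singularHomology.map_id]
  rfl

omit hY in
/-- Pushing forward along the inverse of a homeomorphism and then along it is the identity.
[folklore] -/
theorem map_homeomorph_map_symm {P Q : Type u} [TopologicalSpace P] [TopologicalSpace Q] (e : P ≃ₜ Q)
    (n : ℕ) (c : singularHomology R M Q n) :
    singularHomology.map R M (e : C(P, Q)) n (singularHomology.map R M (e.symm : C(Q, P)) n c) = c :=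
  map_homeomorph_symm_map R M e.symm n c

/-- **Every homology class of `proj⁻¹ Y` is a finite sum of classes carried by the copies of `Y`**
(additivity over the clopen partition by sheets, Hatcher Prop. 2.6, and `sheet ≃ₜ Y`).
[cite: HatcherAT2002, Prop. 2.6] -/
theorem exists_eq_sum_map_sheetEmb (n : ℕ)
    (z : singularHomology R M ↥((proj : CyclicCover f → X) ⁻¹' Y) n) :
    ∃ (S : Finset ℤ) (x : ℤ → singularHomology R M ↥Y n),
      z = ∑ k ∈ S, singularHomology.map R M (sheetEmb hY k) n (x k) := by
  obtain ⟨S, x, rfl⟩ :=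
    singularHomology.exists_eq_sum_map_subsetIncl (R := R) (M := M) (isClopenPartition_sheetIn hY) n z
  refine ⟨S, fun k => singularHomology.map R M
    ((sheetInHomeomorph hY k).symm : C(↥(sheetIn (f := f) Y a k), ↥Y)) n (x k), ?_⟩
  refine Finset.sum_congr rfl fun k _ => ?_
  rw [← subsetIncl_comp_sheetInHomeomorph hY k, singularHomology.map_comp, ModuleCat.comp_apply,
    map_homeomorph_map_symm]

/-- **Independence of the copies**: if a finite sum of classes pushed forward from the copies of
`Y` vanishes in `Hₙ(proj⁻¹ Y)`, every term vanishes. [cite: HatcherAT2002, Prop. 2.6] -/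
theorem eq_zero_of_sum_map_sheetEmb_eq_zero (n : ℕ) (S : Finset ℤ) (x : ℤ → singularHomology R M ↥Y n)
    (hx : ∑ k ∈ S, singularHomology.map R M (sheetEmb hY k) n (x k) = 0) (k : ℤ) (hk : k ∈ S) :
    x k = 0 := by
  have h := singularHomology.eq_zero_of_sum_map_subsetIncl_eq_zero (R := R) (M := M)
    (isClopenPartition_sheetIn hY) n S
    (fun j => singularHomology.map R M (sheetInHomeomorph hY j : C(↥Y, ↥(sheetIn (f := f) Y a j))) n (x j))
    ?_ k hk
  · have h' := congrArg (singularHomology.map R M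
      ((sheetInHomeomorph hY k).symm : C(↥(sheetIn (f := f) Y a k), ↥Y)) n) h
    rwa [map_homeomorph_symm_map, map_zero] at h'
  · rw [← hx]
    refine Finset.sum_congr rfl fun j _ => ?_
    rw [← ModuleCat.comp_apply, ← singularHomology.map_comp, subsetIncl_comp_sheetInHomeomorph]

/-- **Each copy `(sheetEmb k)_* : Hₙ(Y) → Hₙ(proj⁻¹ Y)` is injective.** [cite: HatcherAT2002, Prop. 2.6] -/
theorem map_sheetEmb_injective (n : ℕ) (k : ℤ) : Injective (singularHomology.map R M (sheetEmb hY k) n) := by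
  rw [injective_iff_map_eq_zero]
  intro c hc
  exact eq_zero_of_sum_map_sheetEmb_eq_zero hY R M n {k} (fun _ => c)
    (by rw [Finset.sum_singleton]; exact hc) k (Finset.mem_singleton_self k)

end Over

end CyclicCover

end CircleMaps

end Literature.Topology.FourManifolds
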